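import Literature.AlgebraicGeometry.ComplexMultiplication.EndomorphismFieldTypeOfEqualCharpoly
import Literature.NumberTheory.ComplexMultiplication.CMDefinedOverQbar
import HarnessLib

/-!
# The cotangent characteristic polynomial of a CM structure is `∏_{φ ∈ Φ} (X − φ(a))`, a `ℚ̄`-polynomial;
# the two-fibre bookkeeping of a specialisation argument

Topic `Literature/AlgebraicGeometry/ComplexMultiplication`, namespace `Literature.AlgebraicGeometry.ComplexMultiplication`.
THEOREMS ONLY (no definition, no named fact; net debt 0).  Sequel of `EndomorphismFieldTypeOfEqualCharpoly`; cell
`hodgecm-mathlib`, row II-2β (`shimura1998_prop26_definedOverQbar` `_holds`, plan `PREP-II2beta-Prop26Qbar.md`), junction S1-F4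
between the spread of a CM structure over a finitely generated `ℚ̄`-domain (A-p14) and the type of its `ℚ̄`-fibre (p602731).

THE PRINT.  Howard [Howard2012] §3.1 (display after Def. 3.1.1): «every `x ∈ 𝒪_K` acts on `Lie(A)` with characteristic polynomial
`∏_{φ ∈ Φ} (T − φ(x))`»; Shimura [Shimura1998] §5.2 pp. 36–39 and §12.4 Prop. 26, proof p. 109 (a specialisation of `(A, ι)`
over a place of a finitely generated field of definition, algebraic over `ℚ̄`, «is again of type `(F; {φᵢ})`»): the numbers `φ(x)`
are ALGEBRAIC, so the characteristic polynomial has coefficients in `ℚ̄`, and a polynomial over a `ℚ̄`-algebra `T′ ⊂ ℂ` whose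
image in `ℂ[X]` is a `ℚ̄`-polynomial has the SAME image under every `ℚ̄`-point `T′ → ℚ̄` — which is why the specialised fibre
has the characteristic polynomials, hence (p602731) the type, of the generic one.

WHAT IS PROVED.
* `charpoly_cotangentMap_eq_prod_of_isCMTypeRealisation`: for `(A, ι, θ)` realising `(K; Φ)` over `ℂ` and `a ∈ 𝓞_K`,
  `char(ι(a)^* | 𝔪_e/𝔪_e²) = ∏_{φ ∈ Φ} (X − φ(a))`.
* `exists_map_eq_charpoly_cotangentMap`: that polynomial is the image of a polynomial over `ℚ̄ = algebraicClosure ℚ ℂ`.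
* `map_map_eq_of_map_eq` (pure algebra): for a `k`-algebra `T` with an INJECTIVE `k`-algebra map `ψ : T → C` and a `k`-point
  `u : T → k`, a polynomial `Q ∈ T[X]` with `ψ(Q) = P_C` for some `P ∈ k[X]` has `u(Q)_C = P_C`.
* `charpoly_map_point_eq_of_map_eq` — the two together, in the shape S1-F4 consumes: if the characteristic polynomial `Q_a ∈ T′[X]`
  of an endomorphism on a free `T′`-module (the unit-section conormal module) maps under `ψ : T′ ↪ ℂ` to
  `char(ι(a)^* | 𝔪_e/𝔪_e²(A))`, then its image under any `ℚ̄`-point `u`, read in `ℂ`, is again `char(ι(a)^* | 𝔪_e/𝔪_e²(A))`.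

## References
* [Howard2012] B. Howard, *Complex multiplication cycles and Kudla–Rapoport divisors*, Ann. of Math. 176 (2012), §3.1.
* [Shimura1998] G. Shimura, *Abelian Varieties with Complex Multiplication and Modular Functions* (1998), §5.2; §12.4 Prop. 26.
-/

noncomputable section

namespace Literature.AlgebraicGeometry.ComplexMultiplication

open scoped Polynomial IntermediateField Classical
open CategoryTheory NumberField Module Polynomial
open Literature.AlgebraicGeometry.Motives
open Literature.AlgebraicGeometry.HodgeTheory
open Literature.NumberTheory.ComplexMultiplication

/-! ### §1 Two-fibre bookkeeping (pure algebra) -/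

section Algebra

variable {k T C : Type*} [CommRing k] [CommRing T] [CommRing C] [Algebra k T] [Algebra k C]

/-- **A polynomial over a `k`-algebra `T` whose image under an INJECTIVE `k`-algebra map `ψ : T → C` comes from `k` IS that
`k`-polynomial**: `Q.map ψ = P.map (k → C) → Q = P.map (k → T)`. [folklore] -/
private theorem eq_map_of_map_eq (ψ : T →ₐ[k] C) (hψ : Function.Injective ψ) {Q : T[X]} {P : k[X]}
    (h : Q.map (ψ : T →+* C) = P.map (algebraMap k C)) : Q = P.map (algebraMap k T) := by
  apply Polynomial.map_injective (ψ : T →+* C) hψ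
  rw [h, Polynomial.map_map, AlgHom.comp_algebraMap]

/-- **Two-fibre bookkeeping of a specialisation**: for a `k`-algebra `T` (the finitely generated domain of a spread), an
INJECTIVE `k`-algebra map `ψ : T → C` (the generic complex point) and a `k`-point `u : T → k` (the specialisation), a
polynomial `Q ∈ T[X]` whose image under `ψ` is the image of `P ∈ k[X]` has, under `u` and then `k → C`, the same image:
`(u Q)_C = P_C`.  (With `Q` the characteristic polynomial of an endomorphism on a free `T`-module — the conormal module of the
unit section — the two sides are the cotangent characteristic polynomials of the generic and of the special fibre.)
[cite: Shimura1998, §12.4 Prop. 26 (proof, p. 109)] -/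
theorem map_map_eq_of_map_eq (ψ : T →ₐ[k] C) (hψ : Function.Injective ψ) (u : T →ₐ[k] k) {Q : T[X]} {P : k[X]}
    (h : Q.map (ψ : T →+* C) = P.map (algebraMap k C)) :
    (Q.map (u : T →+* k)).map (algebraMap k C) = P.map (algebraMap k C) := by
  rw [eq_map_of_map_eq ψ hψ h, Polynomial.map_map, Polynomial.map_map, RingHom.comp_assoc, AlgHom.comp_algebraMap,
    Algebra.algebraMap_self, RingHom.comp_id]

end Algebra

/-! ### §2 The cotangent characteristic polynomial of a CM structure -/

section CM

variable {K : Type} [Field K] [NumberField K] {Φ : CMType K} {A : AbelianVariety ℂ} {ι : 𝓞 K →+* End A}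
  {θ : K →+* Module.End ℂ (complexBetti A.X 1)}

/-- **«Every `x ∈ 𝒪_K` acts on `Lie(A)` with characteristic polynomial `∏_{φ ∈ Φ}(T − φ(x))`», cotangent form, for a
realisation `(A, ι, θ)` of `(K; Φ)` on `H¹`** (the tree's `IsCMTypeRealisation`; Lie algebra = dual of `𝔪_e/𝔪_e²`, same
characteristic polynomial; THE type of the pair is `Φ` by `cmTypeOfPair_eq_of_isCMTypeRealisation`).
[cite: Howard2012, §3.1 (display after Def. 3.1.1)] [cite: Shimura1998, §5.2 (pp. 36–39)] -/
theorem charpoly_cotangentMap_eq_prod_of_isCMTypeRealisation (h : IsCMTypeRealisation Φ A ι θ) (a : 𝓞 K) :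
    (Motives.AbelianVariety.cotangentMap A (ι a)).charpoly = ∏ σ : Φ.1, (X - C ((σ.1 (a : K) : ℂ))) := by
  obtain ⟨φA, hφA⟩ := exists_ringHom_endAlgebra (A₀ := A) ι
  have hAdim : finrank ℚ K = 2 * A.dim := h.finrank_eq_two_mul_dim
  have hΦ : cmTypeOfPair φA hAdim = Φ := cmTypeOfPair_eq_of_isCMTypeRealisation φA hAdim h fun b => hφA b
  rw [EndFieldFullDegree.charpoly_cotangentMap_eq_charpoly_lieAction φA (hφA a).symm,
    EndFieldFullDegree.charpoly_lieAction_eq_prod φA hAdim, hΦ]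

/-- The values `φ(a)`, `φ : K → ℂ`, of an algebraic number are in `ℚ̄ = algebraicClosure ℚ ℂ`. [folklore] -/
private theorem apply_mem_algebraicClosure (σ : K →+* ℂ) (a : K) : (σ a : ℂ) ∈ algebraicClosure ℚ ℂ :=
  (mem_algebraicClosure_iff).2 ((Algebra.IsAlgebraic.isAlgebraic a).algHom σ.toRatAlgHom)

/-- **The cotangent characteristic polynomial of a CM structure is a `ℚ̄`-polynomial**: there is `P ∈ ℚ̄[X]`
(`ℚ̄ = algebraicClosure ℚ ℂ`), namely `∏_{φ ∈ Φ} (X − φ(a))` with algebraic roots, mapping to `char(ι(a)^* | 𝔪_e/𝔪_e²)`.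
[cite: Shimura1998, §12.4 Prop. 26 (proof, p. 109) and §5.2] [cite: Howard2012, §3.1] -/
theorem exists_map_eq_charpoly_cotangentMap (h : IsCMTypeRealisation Φ A ι θ) (a : 𝓞 K) :
    ∃ P : (algebraicClosure ℚ ℂ)[X],
      P.map (algebraMap (algebraicClosure ℚ ℂ) ℂ) = (Motives.AbelianVariety.cotangentMap A (ι a)).charpoly := by
  refine ⟨∏ σ : Φ.1, (X - C (⟨σ.1 (a : K), apply_mem_algebraicClosure σ.1 (a : K)⟩ : algebraicClosure ℚ ℂ)), ?_⟩
  rw [charpoly_cotangentMap_eq_prod_of_isCMTypeRealisation h a, Polynomial.map_prod]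
  refine Finset.prod_congr rfl fun σ _ => ?_
  rw [Polynomial.map_sub, Polynomial.map_X, Polynomial.map_C]
  rfl

/-- **The junction S1-F4 in the shape the spread delivers**: let `T′` be a `ℚ̄`-algebra with an injective `ℚ̄`-algebra map
`ψ : T′ → ℂ` and a `ℚ̄`-point `u : T′ → ℚ̄`, and `Q ∈ T′[X]` a polynomial (the characteristic polynomial of `ι(a)` on the
unit-section conormal module) with `ψ(Q) = char(ι(a)^* | 𝔪_e/𝔪_e²(A))` for a realisation `(A, ι, θ)` of `(K; Φ)`; then
`u(Q)`, read in `ℂ`, is again `char(ι(a)^* | 𝔪_e/𝔪_e²(A))` — the specialised fibre has the cotangent characteristic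
polynomials of the generic one (whence the same type by `exists_isCMTypeRealisation_of_forall_charpoly_cotangentMap_eq`).
[cite: Shimura1998, §12.4 Prop. 26 (proof, p. 109)] -/
theorem charpoly_map_point_eq_of_map_eq (h : IsCMTypeRealisation Φ A ι θ) (a : 𝓞 K)
    {T' : Type*} [CommRing T'] [Algebra (algebraicClosure ℚ ℂ) T'] (ψ : T' →ₐ[algebraicClosure ℚ ℂ] ℂ)
    (hψ : Function.Injective ψ) (u : T' →ₐ[algebraicClosure ℚ ℂ] algebraicClosure ℚ ℂ) {Q : T'[X]}
    (hQ : Q.map (ψ : T' →+* ℂ) = (Motives.AbelianVariety.cotangentMap A (ι a)).charpoly) :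
    (Q.map (u : T' →+* algebraicClosure ℚ ℂ)).map (algebraMap (algebraicClosure ℚ ℂ) ℂ) =
      (Motives.AbelianVariety.cotangentMap A (ι a)).charpoly := by
  obtain ⟨P, hP⟩ := exists_map_eq_charpoly_cotangentMap h a
  rw [← hP] at hQ ⊢
  exact map_map_eq_of_map_eq ψ hψ u hQ

end CM

end Literature.AlgebraicGeometry.ComplexMultiplication

end
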